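import Summits.CriticalPhenomena.SAWScalingLimit.Theorems.SAWDevelopingMapNoFoldBoundPeelLocalTerm
import Summits.CriticalPhenomena.SAWScalingLimit.Theorems.SAWDevelopingMapNoFoldBoundPeelPhaseTable

/-!
# Row support for the flat certificate: local double sums as dart lists, and real parts of phases

Helper file for the crux `NoFoldBound` (stmt-CriticalPhenomena-8296) of the route `SAWDevelopingMap`
(sub-problem `SAWScalingLimit` of `CriticalPhenomena`), programme FLAT / PEELED LP of the lead seats
c9–c10 (`FLAT-LEAN-DESIGN.md` on the item, layer L3 generic brick G4). A generated equality row starts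
from `Peel.sum_boundary_darts_observable_eq_zero` for `D = stripDom T L ∖ K`, splits the outer sum over
`y ∈ D` into `y ∈ Loc` (local) and `y ∉ Loc` (far, signed by `Peel.re_far_sum_nonneg`), and must then
EXPAND the local double sum `Σ_{y ∈ Loc} Σ_{w ∈ nbrs y ∖ D}` into an explicit list of darts. This file
provides the generic bookkeeping so that the generator only proves a membership characterisation:

* `sum_split_loc` — `Σ_{y ∈ D} f = Σ_{y ∈ Loc} f + Σ_{y ∈ D ∖ Loc} f` for `Loc ⊆ D`;
* `sum_local_eq_list_sum` — if a duplicate-free list `darts` satisfies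
  `(y, w) ∈ darts ↔ y ∈ Loc ∧ w ∈ nbrs y ∧ w ∉ D`, the local double sum is the list sum over `darts`;
* `re_conj_mul_phase_mul_ofReal` — `Re(ū · (C + iS) · m) = (u.re·C + u.im·S)·m` (how a phase from
  `QT.exp_row_phase` times a real mass enters a real row).
-/

noncomputable section

open scoped BigOperators Classical ComplexConjugate
open Literature.Probability.LatticeModels Literature.Probability.RandomPlanarGeometry.SAW
open Literature.Barriers.CriticalPhenomena.HexGreen (nbrs mem_nbrs_iff)

namespace Summit.CriticalPhenomena.SAWScalingLimit.Theorems.SAWDevelopingMapNoFoldBound.Peel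

/-- **Splitting the outer sum** at a local set `Loc ⊆ D`. -/
theorem sum_split_loc {M : Type*} [AddCommMonoid M] {D Loc : Finset HexVertex} (h : Loc ⊆ D)
    (f : HexVertex → M) : ∑ y ∈ D, f y = ∑ y ∈ Loc, f y + ∑ y ∈ D \ Loc, f y := by
  rw [← Finset.sum_sdiff h, add_comm]

/-- **The local double sum as a list sum over an explicit dart list.** -/
theorem sum_local_eq_list_sum : ∀ {M : Type*} [AddCommMonoid M] {D Loc : Finset HexVertex} (darts : List (HexVertex × HexVertex)), darts.Nodup → (∀ y w : HexVertex, (y, w) ∈ darts ↔ y ∈ Loc ∧ w ∈ Literature.Barriers.CriticalPhenomena.HexGreen.nbrs y ∧ w ∉ D) → ∀ f : HexVertex → HexVertex → M, (∑ y ∈ Loc, ∑ w ∈ (Literature.Barriers.CriticalPhenomena.HexGreen.nbrs y).filter (· ∉ D), f y w) = (darts.map fun d => f d.1 d.2).sum := by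
  intro M _ D Loc darts hnd hchar f
  rw [Finset.sum_sigma' Loc (fun y => (nbrs y).filter (· ∉ D)) f]
  rw [← List.sum_toFinset _ hnd]
  -- the sigma finset and the dart list have the same elements (through `(y,w) ↦ ⟨y,w⟩`)
  refine Finset.sum_nbij' (fun yw => (yw.1, yw.2)) (fun d => ⟨d.1, d.2⟩) ?_ ?_ ?_ ?_ ?_
  · rintro ⟨y, w⟩ hyw
    rw [Finset.mem_sigma, Finset.mem_filter] at hyw
    rw [List.mem_toFinset, hchar]
    exact ⟨hyw.1, hyw.2.1, hyw.2.2⟩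
  · rintro ⟨y, w⟩ hd
    rw [List.mem_toFinset, hchar] at hd
    rw [Finset.mem_sigma, Finset.mem_filter]
    exact ⟨hd.1, hd.2.1, hd.2.2⟩
  · rintro ⟨y, w⟩ _; rfl
  · rintro ⟨y, w⟩ _; rfl
  · rintro ⟨y, w⟩ _; rfl

/-- **Real part of `ū · phase · mass`.** -/
theorem re_conj_mul_phase_mul_ofReal (u : ℂ) (C S m : ℝ) :
    (conj u * ((⟨C, S⟩ : ℂ) * (m : ℂ))).re = (u.re * C + u.im * S) * m := by
  simp [Complex.mul_re, Complex.mul_im, Complex.conj_re, Complex.conj_im]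
  ring

/-- Real part of `ū · (phase · mass)` with the phase written as `e^{i(3/8)W}`, `W = (π/3)·n`. -/
theorem re_conj_mul_rowPhase_mul (u : ℂ) (n : ℤ) (m : ℝ) :
    (conj u * (Complex.exp (Complex.I * (3 / 8 : ℝ) * (((Real.pi / 3 * n : ℝ)) : ℂ)) * (m : ℂ))).re =
      (u.re * QT.eval (Real.sqrt (2 + Real.sqrt 2)) (QT.cosTab (n % 16).toNat) +
        u.im * QT.eval (Real.sqrt (2 + Real.sqrt 2)) (QT.sinTab (n % 16).toNat)) * m := by
  rw [QT.exp_row_phase, re_conj_mul_phase_mul_ofReal]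

/-- Real part of `−ū` (the normalised door term). -/
theorem re_conj_mul_neg_one (u : ℂ) : (conj u * (-1 : ℂ)).re = -u.re := by simp

end Summit.CriticalPhenomena.SAWScalingLimit.Theorems.SAWDevelopingMapNoFoldBound.Peel
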